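import Summits.HubbardSuperconductivity.HubbardSuperconductivity.Theorems.AnisotropyChordTransferFibre3FinXDSound
import Summits.HubbardSuperconductivity.HubbardSuperconductivity.Theorems.AnisotropyChordTransferFibre3FinXB2Cover
import Summits.HubbardSuperconductivity.HubbardSuperconductivity.Theorems.AnisotropyChordTransferFibre3FinXDCheck

/-!
# Route `AnisotropyChord` / H0 rotor rung: FIN per-`L` row-D evaluator XD — the λ-cell cover and the row-D crux `LowShellGFormAbs` per `L`

The per-`L` packaging of the XD cell certificate `…Fibre3FinXDSound.xd_cell_sound` (row-D analogue of `…FinXB2Cover`, same cover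
arithmetic `cover_allQ`, same vacuity branches): one cell of the cover is numerator-vacuous, `Δ`-vacuous on either side of `(0, Δ₁]`, or
certified (`xdCellAnyT`, point tables as arguments; `xdCellAny0` recomputes them); the per-`L` certificate `xdCheck L Δ₁ cells` (points
from `0` to `≥ lamTop L`); ★ `xd_cellAny_sound`, ★ `xd_of_check`, ★★ `lowShellGFormAbs_of_xdCheck` (`LowShellGFormAbs L Δ a` on
`0 < Δ ≤ Δ₁ < 1` for any `a` above every cell constant) and ★★ `lowShellGFormAbs_cell_of_xdCheck` (the per-cell constant).  A kernel fact
`xdCheck L Δ₁ cells = true` is assembled from cell facts `xdCellAny0 L Δ₁ la lb aD = true` (decided directly, or via certified literal point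
tables `xdPoint L la = …` and `xdCellAnyT`).
Prover seat `hubbard-h0-rotor-p3` g7; helper for piece A = stmt-HubbardSuperconductivity-23918 of rung 19089 (`--supports`, helper class).
WHAT THIS IS NOT: nothing here proves superconductivity in the Hubbard model (rotor TARGET as worded stays FALSE, g15 verdict); the FIN form of
ONE hypothesis (the KT-2a row) of ONE conditional reduction.  Tree imports only; no sorry, no new axioms.
-/

set_option linter.dupNamespace false
set_option autoImplicit false

namespace Summit.HubbardSuperconductivity.HubbardSuperconductivity.Theorems.AnisotropyChord.Transfer.Fibre3

namespace FinXD

open scoped BigOperators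
open Finset Hole2 FinCell FinXB


/-- chunking lemma for long row-D certificate lists: `cellsAllQ ok` of `x :: (xs ++ y :: ys)` from `x :: (xs ++ [y])` and `y :: ys`
(the per-`L` assemblies prove chunks by `simp only` with the cell facts and chain them with this). [folklore] -/
theorem cellsAllQ_cons_append (ok : ℤ → ℤ → ℚ → Bool) {x y : ℤ × ℚ} {xs ys : List (ℤ × ℚ)}
    (h1 : cellsAllQ ok (x :: (xs ++ [y])) = true) (h2 : cellsAllQ ok (y :: ys) = true) :
    cellsAllQ ok (x :: (xs ++ y :: ys)) = true := by
  induction xs generalizing x with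
  | nil =>
    simp only [List.nil_append, cellsAllQ, Bool.and_eq_true] at h1 ⊢
    exact ⟨h1.1, h2⟩
  | cons z zs ih =>
    simp only [List.cons_append, cellsAllQ, Bool.and_eq_true] at h1 ⊢
    exact ⟨h1.1, ih h1.2⟩

/-- one cell: for a ground profile at `0 < Δ ≤ Δ₁ < 1` with `λ₂·D` in a cell passing `xdCellAny0`, `lowG ≤ aD·η_eff·U` (`9 ≤ L`). [folklore] -/
theorem xd_cellAny_sound (L : ℕ) [NeZero L] (hL : 9 ≤ L) {d1 : ℚ} {Δ lam2 : ℝ} (hΔ0 : 0 < Δ) (hΔd : Δ ≤ (d1 : ℝ))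
    (hΔ1 : Δ < 1) {f : Tor L → ℝ} (hf : IsGroundTwoMagnon L Δ lam2 f) {la lb : ℤ}
    (hla : (la : ℝ) ≤ lam2 * ((D : ℤ) : ℝ)) (hlb : lam2 * ((D : ℤ) : ℝ) ≤ (lb : ℝ)) {aD : ℚ}
    (hok : xdCellAny0 L d1 la lb aD = true) : lowGForm L Δ f ≤ (aD : ℝ) * etaEff L lam2 * Uunit L Δ f := by
  have hL3 : 3 ≤ L := by omega
  have hL5 : 5 ≤ L := by omega
  have hD := D_pos
  have hlam : 0 < lam2 := lam2_pos L hL3 hΔ1 hf.1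
  have hΔe : Δ = deltaOfLam L lam2 := ground_delta_eq L hL5 hΔ0.le hΔ1 hf
  unfold xdCellAny0 xdCellAnyT at hok
  simp only [Bool.or_eq_true, Bool.and_eq_true, decide_eq_true_eq] at hok
  rcases hok with (⟨⟨hpos, hnum⟩, hG0⟩ | ⟨hgc, hvac⟩) | hcert
  · exact (vacuous_of_num_neg (L := L) hL3 hlam hla hlb hpos hnum hG0 hΔ0 hΔ1 hΔe).elim
  · exfalso
    have hmd := mem_delta_cell L hL3 hlam hla hlb hgc
    rw [← hΔe] at hmd
    obtain ⟨hlo, hhi⟩ := hmd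
    rcases hvac with hneg | hbig
    · have : ((((deltaIv L la lb).2 : ℤ)) : ℝ) < 0 := by exact_mod_cast hneg
      nlinarith
    · have hbig' : (d1 : ℝ) * ((D : ℤ) : ℝ) < ((((deltaIv L la lb).1 : ℤ)) : ℝ) := by
        have := hbig
        have e : (((D : ℚ)) : ℝ) = ((D : ℤ) : ℝ) := by norm_cast
        rw [← e]; exact_mod_cast this
      nlinarith
  · exact xd_cell_sound hL hΔ0.le hΔ1 hf hla hlb hcert

/-- ★ from the per-`L` XD certificate: every ground profile at `0 < Δ ≤ Δ₁`, `Δ < 1` satisfies `lowG ≤ aD·η_eff·U` with the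
constant of its cell (some entry of the list). [folklore] -/
theorem xd_of_check (L : ℕ) [NeZero L] (hL : 9 ≤ L) {d1 : ℚ} {cells : List (ℤ × ℚ)} (h : xdCheck L d1 cells = true)
    {Δ : ℝ} (hΔ0 : 0 < Δ) (hΔd : Δ ≤ (d1 : ℝ)) (hΔ1 : Δ < 1) :
    ∀ lam2 : ℝ, ∀ f : Tor L → ℝ, IsGroundTwoMagnon L Δ lam2 f →
      ∃ q ∈ cells.map Prod.snd, lowGForm L Δ f ≤ (q : ℝ) * etaEff L lam2 * Uunit L Δ f := by
  refine forall_ground_of_window_7 L (by omega) hΔ0.le hΔ1 _ ?_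
  intro lam2 f hf hlam0 hlamle
  have hD := D_pos
  unfold xdCheck at h
  simp only [Bool.and_eq_true, decide_eq_true_eq] at h
  obtain ⟨⟨⟨hhead, hlen⟩, htop⟩, hok⟩ := h
  obtain ⟨a, b, rest, hcells⟩ : ∃ a b : ℤ × ℚ, ∃ rest : List (ℤ × ℚ), cells = a :: b :: rest := by
    match cells, hlen with
    | a :: b :: rest, _ => exact ⟨a, b, rest, rfl⟩
  subst hcells
  have ha0 : a.1 = 0 := by simpa using hhead
  set x : ℝ := lam2 * ((D : ℤ) : ℝ) with hx
  have hx0 : (a.1 : ℝ) ≤ x := by rw [ha0, hx]; push_cast; positivity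
  have hxtop : x ≤ ((cellsLastQ (a :: b :: rest) : ℤ) : ℝ) :=
    (lam_mul_D_le_lamTop L (by omega) hlamle).trans (by exact_mod_cast htop)
  obtain ⟨c, d, q, hcell, hcx, hxd, hq⟩ := cover_allQ (xdCellAny0 L d1) rest a b x hok hx0 hxtop
  exact ⟨q, hq, xd_cellAny_sound L hL hΔ0 hΔd hΔ1 hf hcx hxd hcell⟩

/-- ★★ THE ROW-D CRUX AT THIS `L` with a uniform constant: `LowShellGFormAbs L Δ a` for `0 < Δ ≤ Δ₁`, `Δ < 1` and any `a`
above every cell constant. [folklore] -/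
theorem lowShellGFormAbs_of_xdCheck (L : ℕ) [NeZero L] (hL : 9 ≤ L) {d1 : ℚ} {cells : List (ℤ × ℚ)}
    (h : xdCheck L d1 cells = true) {a : ℚ} (ha : ∀ q ∈ cells.map Prod.snd, q ≤ a)
    {Δ : ℝ} (hΔ0 : 0 < Δ) (hΔd : Δ ≤ (d1 : ℝ)) (hΔ1 : Δ < 1) :
    LowShellGFormAbs L Δ a := by
  intro lam2 f hf
  obtain ⟨q, hq, hle⟩ := xd_of_check L hL h hΔ0 hΔd hΔ1 lam2 f hf
  have hU : 0 < Uunit L Δ f := by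
    unfold Uunit
    have hT := Tplus_pos L (by omega) hΔ1 hf
    have hLpos : (0 : ℝ) < L := by exact_mod_cast (show 0 < L by omega)
    positivity
  have hη : 0 < etaEff L lam2 := by
    unfold etaEff
    have := lam2_pos L (by omega) hΔ1 hf.1
    have hLpos : (0 : ℝ) < L := by exact_mod_cast (show 0 < L by omega)
    positivity
  have hqa : ((q : ℚ) : ℝ) ≤ ((a : ℚ) : ℝ) := by exact_mod_cast ha q hq
  exact hle.trans (mul_le_mul_of_nonneg_right (mul_le_mul_of_nonneg_right hqa hη.le) hU.le)

/-- ★★ the per-cell form: at `0 < Δ ≤ Δ₁`, `Δ < 1`, there is a cell constant `q` (that of the cell of the ground `λ₂(Δ)`) with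
`LowShellGFormAbs L Δ q`. [folklore] -/
theorem lowShellGFormAbs_cell_of_xdCheck (L : ℕ) [NeZero L] (hL : 9 ≤ L) {d1 : ℚ} {cells : List (ℤ × ℚ)}
    (h : xdCheck L d1 cells = true) {Δ : ℝ} (hΔ0 : 0 < Δ) (hΔd : Δ ≤ (d1 : ℝ)) (hΔ1 : Δ < 1) :
    ∃ q ∈ cells.map Prod.snd, LowShellGFormAbs L Δ q := by
  obtain ⟨lam2, f, hf⟩ := exists_ground L (by omega) Δ
  obtain ⟨q, hq, hle⟩ := xd_of_check L hL h hΔ0 hΔd hΔ1 lam2 f hf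
  refine ⟨q, hq, fun lam2' f' hf' => ?_⟩
  have hl : lam2' = lam2 := ground_lam2_unique L (by omega) hf' hf
  subst hl
  have hff : f' = f := by
    rw [ground_eq_explicit L (by omega) hΔ0.le hΔ1 hf', ground_eq_explicit L (by omega) hΔ0.le hΔ1 hf]
  subst hff
  exact hle

end FinXD

end Summit.HubbardSuperconductivity.HubbardSuperconductivity.Theorems.AnisotropyChord.Transfer.Fibre3
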